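import Literature.AnabelianGeometry.EtaleTheta.Discharge.Sec5Prop53LabelsR

/-!
# [EtTh] §5, Proposition 5.3 (vi) over the repaired divisor-support vocabulary (p.326–327 / PDF pp.100–101)

Mochizuki, *The étale theta function …*, Publ. RIMS **45** (2009)
[cite: MochizukiEtTh2009, Prop 5.3 (vi) p.326 (PDF p.100); proof p.327 (PDF p.101); Prop 1.4 (i) p.247 (PDF p.21); §1 p.244 (PDF p.18)].
Seat abc-iut-L2-d4 (merge row W3-L2-03), PROOF-ONLY, over abc-iut-L6-d1's `DivisorSupportData'` (`FrobenioidThetaDivisorSupportR.lean`).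

Prop. 5.3 (vi): `Ψ^Φ_{A_⊚}` [on `Φ(A_⊚)^gp`] preserves "the `Aut_C(A_⊚)`-orbit of the divisor of zeroes and
poles `∈ Φ(A_⊚)^gp` of … the theta function `Θ̈`" (`PreservesThetaDivisorOrbit`).  Print (p.327 (PDF p.101)):
"the preservation of (vi) … follows … in light of the preservation of (i), (ii), (iii), and (v) [cf. the
description of the divisor of zeroes and poles of `Θ̈` in Proposition 1.4, (i)]".  This file derives (vi) from
(i) on primes and (v) by a direct divisor-profile argument (a variant of the printed route, which passes through
the principal divisors), with two facts about the GENUINE special fibre entering as hypothesis binders (asserted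
nowhere, D-0067):

* `hdiv` — "the description of the divisor of zeroes and poles of `Θ̈` in Proposition 1.4, (i)" (p.247 (PDF
  p.21): "The zeroes of `Θ̈` on `Ÿ` are precisely the cusps of `Ÿ`; each zero has multiplicity 1.  The divisor of
  poles of `Θ̈` on `Ÿ` is precisely the divisor `D₁`", and p.244 (PDF p.18): "at the irreducible component labeled
  `j`, the divisor `D_N` is … the schematic zero locus of `q_X^{j²/2N}`") on the non-cuspidal primes: the order
  of `div(Θ̈)` at the component labelled `j ∈ ℤ` is `θ j` for a profile `θ : ℤ → ℚ` with `θ (s - j) = θ j`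
  (`−j²·ord(q_X)/2` is symmetric about `0` in print's labels, hence about some `s/2`, `s ∈ ℤ`, in the chosen
  labels `ncspEquivZ`); the cuspidal half is field F5 `ordGp_divTheta_cusp`;
* `hAut` — every `g ∈ Aut_C(A_⊚)` preserves cuspidality and acts on the labels of the chain of components
  through `ℤ ⋊ {±1}` (§1 p.238–239, 244 (PDF pp.12–13, 18): the special fibre is "an infinite chain of copies of
  the projective line" whose dual graph `Aut` acts on; the translations are realised, field F6 `exists_translate`).

Given these, (i) on primes (`CuspPreserved`) and (v) (`PreservesNcspLabels`) imply (vi): the orbit is the set of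
elements of `Φ(A_⊚)^gp` with cuspidal orders `1` and non-cuspidal profile a translate of `θ`
(`mem_thetaOrbit_iff_profile'`), any cuspidality-preserving monoid automorphism acting affinely on the labels
permutes these profiles (`profile_gpMap'`), and an element of `Φ(A_⊚)^gp` is determined by its orders
(`eq_of_ordGp_eq'`, from the injectivity of the REPAIRED product-valued factorization F2).  (The isomorphisms of
(ii)/(iii) are implicit in the prime-log-divisor coordinates `gen 𝔭` of F2, cf. `map_gen'`.)
HONEST FRAMING: kernel-checked implication; typed ≠ discharged; no side taken on anything downstream. -/

namespace Literature.AnabelianGeometry.EtaleTheta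

open CategoryTheory
open Literature.AlgebraicGeometry.Frobenioids

universe w v v' u u'

namespace FrobenioidThetaDivisors

/-! ### Inverse transport of cuspidality and labels -/

namespace DivisorPrimeData

variable {C : Type u} [Category.{v} C] {D : Type u'} [Category.{v'} D] {𝔉 : ThetaFrobenioid.{w} C D}
  (𝔓 : DivisorPrimeData 𝔉) (φ : 𝔉.PhiAcirc ≃* 𝔉.PhiAcirc)

/-- If `φ` preserves cuspidality of primes, so does `φ⁻¹`. [cite: MochizukiEtTh2009, Prop 5.3 (i) p.325 (PDF p.99)] -/
theorem isCuspidal_congr_symm_iff (hφc : ∀ 𝔭, 𝔓.IsCuspidal (Primes.congr φ 𝔭) ↔ 𝔓.IsCuspidal 𝔭)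
    (𝔮 : Primes 𝔉.PhiAcirc) : 𝔓.IsCuspidal (Primes.congr φ.symm 𝔮) ↔ 𝔓.IsCuspidal 𝔮 := by
  have h := hφc (Primes.congr φ.symm 𝔮)
  rw [Primes.congr_apply_congr_symm] at h
  exact h.symm

/-- If `φ` acts on the labels of the non-cuspidal primes by `j ↦ ε j + c` (`ε = ±1`), then `φ⁻¹` acts by
`j ↦ ε j − ε c`. [cite: MochizukiEtTh2009, Prop 5.3 (v) p.325 (PDF p.99)] -/
theorem ncspEquivZ_congr_symm (ε : ℤˣ) (c : ℤ)
    (hφL : ∀ (𝔭 : Primes 𝔉.PhiAcirc) (h𝔭 : ¬ 𝔓.IsCuspidal 𝔭) (h𝔭' : ¬ 𝔓.IsCuspidal (Primes.congr φ 𝔭)),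
      𝔓.ncspEquivZ ⟨Primes.congr φ 𝔭, h𝔭'⟩ = ε * 𝔓.ncspEquivZ ⟨𝔭, h𝔭⟩ + c)
    (𝔮 : Primes 𝔉.PhiAcirc) (h𝔮 : ¬ 𝔓.IsCuspidal 𝔮) (h𝔮' : ¬ 𝔓.IsCuspidal (Primes.congr φ.symm 𝔮)) :
    𝔓.ncspEquivZ ⟨Primes.congr φ.symm 𝔮, h𝔮'⟩ = ε * 𝔓.ncspEquivZ ⟨𝔮, h𝔮⟩ + -(ε * c) := by
  have h'' : ¬ 𝔓.IsCuspidal (Primes.congr φ (Primes.congr φ.symm 𝔮)) := by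
    rw [Primes.congr_apply_congr_symm]; exact h𝔮
  have h := hφL (Primes.congr φ.symm 𝔮) h𝔮' h''
  have hsub : (⟨Primes.congr φ (Primes.congr φ.symm 𝔮), h''⟩ : {p : Primes 𝔉.PhiAcirc // ¬ 𝔓.IsCuspidal p}) =
      ⟨𝔮, h𝔮⟩ := Subtype.ext (Primes.congr_apply_congr_symm φ 𝔮)
  rw [hsub] at h
  rcases Int.units_eq_one_or ε with rfl | rfl
  · rw [Units.val_one] at h ⊢; omega
  · rw [Units.val_neg, Units.val_one] at h ⊢; omega

end DivisorPrimeData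

namespace DivisorSupportData'

variable {C : Type u} [Category.{v} C] {D : Type u'} [Category.{v'} D] {𝔉 : ThetaFrobenioid.{w} C D}
  {𝔓 : DivisorPrimeData 𝔉}

/-! ### An element of `Φ(A_⊚)^gp` is determined by its orders -/

/-- Every element of a Grothendieck group is a fraction. [folklore] -/
private theorem exists_eq_of_div_of {M : Type*} [CommMonoid M] (z : Algebra.GrothendieckGroup M) :
    ∃ a b : M, z = Algebra.GrothendieckGroup.of a / Algebra.GrothendieckGroup.of b := by
  induction z using Localization.induction_on with
  | H y =>
    refine ⟨y.1, y.2, eq_div_iff_mul_eq'.mpr ?_⟩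
    rw [Localization.mk_eq_monoidOf_mk'_apply]
    exact Submonoid.LocalizationMap.mk'_spec _ _ _

/-- **`x ∈ Φ(A_⊚)^gp` is determined by its orders `(ord_𝔭 x)_𝔭`** — the REPAIRED F2 is an injective
product-valued factorization ([EtTh] Prop. 3.2 (i) p.296 (PDF p.70); [FrdI] Def. 2.4 (i)(c)).
[cite: MochizukiEtTh2009, Prop 3.2 (i) p.296 (PDF p.70); Prop 5.3 proof p.326 (PDF p.100)] -/
theorem eq_of_ordGp_eq' (𝔖 : DivisorSupportData' 𝔓) {x y : Algebra.GrothendieckGroup 𝔉.PhiAcirc}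
    (h : ∀ 𝔭, 𝔖.ordGp 𝔭 x = 𝔖.ordGp 𝔭 y) : x = y := by
  obtain ⟨a, b, rfl⟩ := exists_eq_of_div_of x
  obtain ⟨c, d, rfl⟩ := exists_eq_of_div_of y
  rw [div_eq_div_iff_mul_eq_mul, ← map_mul, ← map_mul]
  refine congrArg Algebra.GrothendieckGroup.of (𝔖.factor_injective (funext fun 𝔭 => ?_))
  have h𝔭 := h 𝔭
  rw [map_div, map_div, ordGp_of', ordGp_of', ordGp_of', ordGp_of', div_eq_div_iff_mul_eq_mul] at h𝔭
  rw [map_mul, map_mul, Pi.mul_apply, Pi.mul_apply]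
  exact h𝔭

/-- `x ∈ Φ(A_⊚)^gp` is determined by its (additive, `ℚ`-valued) orders.
[cite: MochizukiEtTh2009, Prop 5.3 proof p.326 (PDF p.100)] -/
theorem eq_of_ord_eq' (𝔖 : DivisorSupportData' 𝔓) {x y : Algebra.GrothendieckGroup 𝔉.PhiAcirc}
    (h : ∀ 𝔭, 𝔖.ord 𝔭 x = 𝔖.ord 𝔭 y) : x = y :=
  𝔖.eq_of_ordGp_eq' fun 𝔭 => Multiplicative.toAdd.injective (h 𝔭)

/-- The orders of a transported element: `ord_𝔮(φ^gp x) = ord_{φ⁻¹ 𝔮}(x)`.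
[cite: MochizukiEtTh2009, Prop 5.3 proof p.326 (PDF p.100)] -/
theorem ord_gpMap' (𝔖 : DivisorSupportData' 𝔓) (φ : 𝔉.PhiAcirc ≃* 𝔉.PhiAcirc) (𝔮 : Primes 𝔉.PhiAcirc)
    (x : Algebra.GrothendieckGroup 𝔉.PhiAcirc) :
    𝔖.ord 𝔮 (ThetaFrobenioid.gpMap φ.toMonoidHom x) = 𝔖.ord (Primes.congr φ.symm 𝔮) x := by
  have h := 𝔖.ordGp_gpMap' φ (Primes.congr φ.symm 𝔮) x
  rw [Primes.congr_apply_congr_symm] at h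
  simp only [DivisorSupportData'.ord, h]

/-- F5 in additive form: `ord_𝔠(div Θ̈) = 1` at every cuspidal prime (Prop. 1.4 (i)).
[cite: MochizukiEtTh2009, Prop 1.4 (i) p.247 (PDF p.21); Prop 5.3 (vi) p.326 (PDF p.100)] -/
theorem ord_divTheta_cusp' (𝔖 : DivisorSupportData' 𝔓) (𝔠 : Primes 𝔉.PhiAcirc) (h𝔠 : 𝔓.IsCuspidal 𝔠) :
    𝔖.ord 𝔠 𝔓.divTheta = 1 := by
  show Multiplicative.toAdd (ordGpOf' 𝔖.factor 𝔠 𝔓.divTheta) = 1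
  rw [𝔖.ordGp_divTheta_cusp 𝔠 h𝔠]
  rfl

/-! ### Profiles: cuspidal orders `1`, non-cuspidal orders a translate of `θ` -/

/-- **Transport of profiles.**  If `φ` preserves cuspidality and acts on the labels by `j ↦ ε j + c`, and `x` has
cuspidal orders `1` and non-cuspidal orders `θ(j − t)` for a profile `θ` with `θ (s − j) = θ j`, then `φ^gp x` has
cuspidal orders `1` and non-cuspidal orders `θ(j − t')`, `t' = c + t` (`ε = 1`) resp. `c − t − s` (`ε = −1`).
[cite: MochizukiEtTh2009, Prop 5.3 proof p.327 (PDF p.101)] -/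
theorem profile_gpMap' (𝔖 : DivisorSupportData' 𝔓) (φ : 𝔉.PhiAcirc ≃* 𝔉.PhiAcirc)
    (hφc : ∀ 𝔭, 𝔓.IsCuspidal (Primes.congr φ 𝔭) ↔ 𝔓.IsCuspidal 𝔭) (ε : ℤˣ) (c : ℤ)
    (hφL : ∀ (𝔭 : Primes 𝔉.PhiAcirc) (h𝔭 : ¬ 𝔓.IsCuspidal 𝔭) (h𝔭' : ¬ 𝔓.IsCuspidal (Primes.congr φ 𝔭)),
      𝔓.ncspEquivZ ⟨Primes.congr φ 𝔭, h𝔭'⟩ = ε * 𝔓.ncspEquivZ ⟨𝔭, h𝔭⟩ + c)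
    (θ : ℤ → ℚ) (s : ℤ) (hθ : ∀ j, θ (s - j) = θ j) (x : Algebra.GrothendieckGroup 𝔉.PhiAcirc) (t : ℤ)
    (hx₁ : ∀ 𝔠, 𝔓.IsCuspidal 𝔠 → 𝔖.ord 𝔠 x = 1)
    (hx₂ : ∀ (𝔫 : Primes 𝔉.PhiAcirc) (h𝔫 : ¬ 𝔓.IsCuspidal 𝔫),
      𝔖.ord 𝔫 x = θ (𝔓.ncspEquivZ ⟨𝔫, h𝔫⟩ - t)) :
    (∀ 𝔠, 𝔓.IsCuspidal 𝔠 → 𝔖.ord 𝔠 (ThetaFrobenioid.gpMap (φ : 𝔉.PhiAcirc →* 𝔉.PhiAcirc) x) = 1) ∧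
      ∀ (𝔫 : Primes 𝔉.PhiAcirc) (h𝔫 : ¬ 𝔓.IsCuspidal 𝔫),
        𝔖.ord 𝔫 (ThetaFrobenioid.gpMap (φ : 𝔉.PhiAcirc →* 𝔉.PhiAcirc) x) =
          θ (𝔓.ncspEquivZ ⟨𝔫, h𝔫⟩ - (if ε = 1 then c + t else c - t - s)) := by
  have hc' := 𝔓.isCuspidal_congr_symm_iff φ hφc
  have hL' := 𝔓.ncspEquivZ_congr_symm φ ε c hφL
  rw [← MulEquiv.toMonoidHom_eq_coe]
  refine ⟨fun 𝔠 h𝔠 => ?_, fun 𝔫 h𝔫 => ?_⟩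
  · rw [ord_gpMap']
    exact hx₁ _ ((hc' 𝔠).mpr h𝔠)
  · rw [ord_gpMap', hx₂ _ ((hc' 𝔫).not.mpr h𝔫), hL' 𝔫 h𝔫 ((hc' 𝔫).not.mpr h𝔫)]
    rcases Int.units_eq_one_or ε with rfl | rfl
    · rw [if_pos rfl, Units.val_one]
      congr 1; ring
    · rw [if_neg (by decide), Units.val_neg, Units.val_one, ← hθ]
      congr 1; ring

/-- **The `Aut_C(A_⊚)`-orbit of `div(Θ̈)` is the set of elements with cuspidal orders `1` and non-cuspidal
orders a translate of the profile `θ`** (given `hdiv`, `hAut`, F5, F6 and the injectivity of F2).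
[cite: MochizukiEtTh2009, Prop 5.3 (vi) p.326 (PDF p.100); proof p.327 (PDF p.101)] -/
theorem mem_thetaOrbit_iff_profile' (𝔖 : DivisorSupportData' 𝔓) (θ : ℤ → ℚ) (s : ℤ)
    (hθ : ∀ j, θ (s - j) = θ j)
    (hdiv : ∀ (𝔫 : Primes 𝔉.PhiAcirc) (h𝔫 : ¬ 𝔓.IsCuspidal 𝔫),
      𝔖.ord 𝔫 𝔓.divTheta = θ (𝔓.ncspEquivZ ⟨𝔫, h𝔫⟩))
    (hAut : ∀ g : Aut 𝔉.Acirc, (∀ 𝔭, 𝔓.IsCuspidal (Primes.congr (𝔉.pullAut g) 𝔭) ↔ 𝔓.IsCuspidal 𝔭) ∧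
      ∃ (ε : ℤˣ) (c : ℤ), ∀ (𝔭 : Primes 𝔉.PhiAcirc) (h𝔭 : ¬ 𝔓.IsCuspidal 𝔭)
        (h𝔭' : ¬ 𝔓.IsCuspidal (Primes.congr (𝔉.pullAut g) 𝔭)),
        𝔓.ncspEquivZ ⟨Primes.congr (𝔉.pullAut g) 𝔭, h𝔭'⟩ = ε * 𝔓.ncspEquivZ ⟨𝔭, h𝔭⟩ + c)
    (x : Algebra.GrothendieckGroup 𝔉.PhiAcirc) :
    x ∈ Set.range (fun g : Aut 𝔉.Acirc =>
        ThetaFrobenioid.gpMap (𝔉.pullAut g : 𝔉.PhiAcirc →* 𝔉.PhiAcirc) 𝔓.divTheta) ↔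
      ∃ t : ℤ, (∀ 𝔠, 𝔓.IsCuspidal 𝔠 → 𝔖.ord 𝔠 x = 1) ∧
        ∀ (𝔫 : Primes 𝔉.PhiAcirc) (h𝔫 : ¬ 𝔓.IsCuspidal 𝔫), 𝔖.ord 𝔫 x = θ (𝔓.ncspEquivZ ⟨𝔫, h𝔫⟩ - t) := by
  have h0 : ∀ (𝔫 : Primes 𝔉.PhiAcirc) (h𝔫 : ¬ 𝔓.IsCuspidal 𝔫),
      𝔖.ord 𝔫 𝔓.divTheta = θ (𝔓.ncspEquivZ ⟨𝔫, h𝔫⟩ - 0) := fun 𝔫 h𝔫 => by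
    rw [sub_zero]; exact hdiv 𝔫 h𝔫
  constructor
  · rintro ⟨g, rfl⟩
    obtain ⟨hgc, ε, c, hgL⟩ := hAut g
    exact ⟨_, 𝔖.profile_gpMap' (𝔉.pullAut g) hgc ε c hgL θ s hθ 𝔓.divTheta 0 (𝔖.ord_divTheta_cusp') h0⟩
  · rintro ⟨t, h₁, h₂⟩
    obtain ⟨g, hgc, hgL⟩ := 𝔖.exists_translate t
    have hgL' : ∀ (𝔭 : Primes 𝔉.PhiAcirc) (h𝔭 : ¬ 𝔓.IsCuspidal 𝔭)
        (h𝔭' : ¬ 𝔓.IsCuspidal (Primes.congr (𝔉.pullAut g) 𝔭)),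
        𝔓.ncspEquivZ ⟨Primes.congr (𝔉.pullAut g) 𝔭, h𝔭'⟩ = ((1 : ℤˣ) : ℤ) * 𝔓.ncspEquivZ ⟨𝔭, h𝔭⟩ + t :=
      fun 𝔭 h𝔭 h𝔭' => by rw [Units.val_one, one_mul]; exact hgL 𝔭 h𝔭 h𝔭'
    obtain ⟨k₁, k₂⟩ := 𝔖.profile_gpMap' (𝔉.pullAut g) hgc 1 t hgL' θ s hθ 𝔓.divTheta 0 (𝔖.ord_divTheta_cusp') h0
    refine ⟨g, (𝔖.eq_of_ord_eq' fun 𝔭 => ?_)⟩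
    by_cases h𝔭 : 𝔓.IsCuspidal 𝔭
    · rw [k₁ 𝔭 h𝔭, h₁ 𝔭 h𝔭]
    · rw [k₂ 𝔭 h𝔭, h₂ 𝔭 h𝔭, if_pos rfl, add_zero]

end DivisorSupportData'

/-! ### Proposition 5.3 (vi) from (i), (v), the profile of `div(Θ̈)` and the action of `Aut_C(A_⊚)` on the chain -/

section Prop53vi

variable {C : Type u} [Category.{v} C] {D : Type u'} [Category.{v'} D] {𝔉 : ThetaFrobenioid.{w} C D}
  {𝔓 : DivisorPrimeData 𝔉} (Ψ : C ≌ C) (ι : Ψ.functor.obj 𝔉.Acirc ≅ 𝔉.Acirc)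
  (e : 𝔉.PhiAcirc ≃* 𝔉.pre.Mon (𝔉.base.obj (Ψ.functor.obj 𝔉.Acirc)))

/-- **[EtTh] Proposition 5.3 (vi) over the repaired data** — "`Ψ^Φ_{A_⊚}` preserves the `Aut_C(A_⊚)`-orbit of
the divisor of zeroes and poles `∈ Φ(A_⊚)^gp` of … `Θ̈`" — from (i) on primes (`hc`), (v) (`hL`), "the
description of the divisor of zeroes and poles of `Θ̈` in Proposition 1.4, (i)" (`hdiv` with a profile `θ`
symmetric about a half-integer, and F5), and the action of `Aut_C(A_⊚)` on the chain of components through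
`ℤ ⋊ {±1}` (`hAut`; translations realised, F6); print p.327 (PDF p.101): "follows … in light of the preservation of
(i), (ii), (iii), and (v)".
[cite: MochizukiEtTh2009, Prop 5.3 (vi) p.326 (PDF p.100); proof p.327 (PDF p.101); Prop 1.4 (i) p.247 (PDF p.21)] -/
theorem preservesThetaDivisorOrbit_of_profile' (𝔖 : DivisorSupportData' 𝔓) (hc : CuspPreserved 𝔓 Ψ ι e)
    (hL : PreservesNcspLabels 𝔓 Ψ ι e hc) (θ : ℤ → ℚ) (s : ℤ) (hθ : ∀ j, θ (s - j) = θ j)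
    (hdiv : ∀ (𝔫 : Primes 𝔉.PhiAcirc) (h𝔫 : ¬ 𝔓.IsCuspidal 𝔫),
      𝔖.ord 𝔫 𝔓.divTheta = θ (𝔓.ncspEquivZ ⟨𝔫, h𝔫⟩))
    (hAut : ∀ g : Aut 𝔉.Acirc, (∀ 𝔭, 𝔓.IsCuspidal (Primes.congr (𝔉.pullAut g) 𝔭) ↔ 𝔓.IsCuspidal 𝔭) ∧
      ∃ (ε : ℤˣ) (c : ℤ), ∀ (𝔭 : Primes 𝔉.PhiAcirc) (h𝔭 : ¬ 𝔓.IsCuspidal 𝔭)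
        (h𝔭' : ¬ 𝔓.IsCuspidal (Primes.congr (𝔉.pullAut g) 𝔭)),
        𝔓.ncspEquivZ ⟨Primes.congr (𝔉.pullAut g) 𝔭, h𝔭'⟩ = ε * 𝔓.ncspEquivZ ⟨𝔭, h𝔭⟩ + c) :
    PreservesThetaDivisorOrbit 𝔓 Ψ ι e := by
  obtain ⟨ε, c, hLab⟩ := hL
  set ψ := psiPhi 𝔉 Ψ ι e with hψ
  have hLab' : ∀ (𝔭 : Primes 𝔉.PhiAcirc) (h𝔭 : ¬ 𝔓.IsCuspidal 𝔭) (h𝔭' : ¬ 𝔓.IsCuspidal (Primes.congr ψ 𝔭)),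
      𝔓.ncspEquivZ ⟨Primes.congr ψ 𝔭, h𝔭'⟩ = ε * 𝔓.ncspEquivZ ⟨𝔭, h𝔭⟩ + c := fun 𝔭 h𝔭 _ => hLab 𝔭 h𝔭
  have hc' := 𝔓.isCuspidal_congr_symm_iff ψ hc
  have hL' := 𝔓.ncspEquivZ_congr_symm ψ ε c hLab'
  show _ '' _ = _
  ext x
  constructor
  · rintro ⟨y, hy, rfl⟩
    rw [𝔖.mem_thetaOrbit_iff_profile' θ s hθ hdiv hAut] at hy
    obtain ⟨t, h₁, h₂⟩ := hy
    exact (𝔖.mem_thetaOrbit_iff_profile' θ s hθ hdiv hAut _).mpr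
      ⟨_, 𝔖.profile_gpMap' ψ hc ε c hLab' θ s hθ y t h₁ h₂⟩
  · intro hx
    rw [𝔖.mem_thetaOrbit_iff_profile' θ s hθ hdiv hAut] at hx
    obtain ⟨t, h₁, h₂⟩ := hx
    refine ⟨ThetaFrobenioid.gpMap (ψ.symm : 𝔉.PhiAcirc →* 𝔉.PhiAcirc) x,
      (𝔖.mem_thetaOrbit_iff_profile' θ s hθ hdiv hAut _).mpr
        ⟨_, 𝔖.profile_gpMap' ψ.symm hc' ε (-(ε * c)) hL' θ s hθ x t h₁ h₂⟩, ?_⟩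
    rw [← MulEquiv.toMonoidHom_eq_coe, ← MulEquiv.toMonoidHom_eq_coe]
    exact DivisorSupportData.gpMap_gpMap_symm ψ x

/-- **[EtTh] Proposition 5.3, all six parts, over the repaired data** (`GeometryOfDivisorsPreserved`): from the
`Ψ`-induced isomorphism of divisor monoids (`hind`, [FrdI] Thm. 4.9) and (i) as typed (`PreservesCuspidality`,
Cor. 3.8 (iii)), the parts (ii), (iii) follow from the prime-log-divisor coordinates of `DivisorSupportData'`,
(iv) and (v) from F1-Ψ (`hP`) and the printed criteria (`CspToNcspWitnessed'`, `CspToNcspCriterion'`,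
`AdjacencyCriterion'` — abc-iut-L6-d1's row), and (vi) from the profile of `div(Θ̈)` (`hdiv`, Prop. 1.4 (i)) and
the action of `Aut_C(A_⊚)` on the chain (`hAut`).
[cite: MochizukiEtTh2009, Prop 5.3 p.325–326 (PDF pp.99–100); proof p.326–327 (PDF pp.100–101)] -/
theorem geometryOfDivisorsPreserved_of_supportData' (T : DivisorTransportStub 𝔉) (𝔖 : DivisorSupportData' 𝔓)
    (hind : T.IsInducedBy Ψ 𝔉.Acirc e) (hi : PreservesCuspidality T 𝔓 Ψ ι e)
    (hP : ∀ x, ThetaFrobenioid.gpMap (psiPhi 𝔉 Ψ ι e).toMonoidHom x ∈ 𝔖.principal ↔ x ∈ 𝔖.principal)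
    (hW : CspToNcspWitnessed' 𝔖) (hCrit : CspToNcspCriterion' 𝔖) (hAdj : AdjacencyCriterion' 𝔖)
    (θ : ℤ → ℚ) (s : ℤ) (hθ : ∀ j, θ (s - j) = θ j)
    (hdiv : ∀ (𝔫 : Primes 𝔉.PhiAcirc) (h𝔫 : ¬ 𝔓.IsCuspidal 𝔫),
      𝔖.ord 𝔫 𝔓.divTheta = θ (𝔓.ncspEquivZ ⟨𝔫, h𝔫⟩))
    (hAut : ∀ g : Aut 𝔉.Acirc, (∀ 𝔭, 𝔓.IsCuspidal (Primes.congr (𝔉.pullAut g) 𝔭) ↔ 𝔓.IsCuspidal 𝔭) ∧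
      ∃ (ε : ℤˣ) (c : ℤ), ∀ (𝔭 : Primes 𝔉.PhiAcirc) (h𝔭 : ¬ 𝔓.IsCuspidal 𝔭)
        (h𝔭' : ¬ 𝔓.IsCuspidal (Primes.congr (𝔉.pullAut g) 𝔭)),
        𝔓.ncspEquivZ ⟨Primes.congr (𝔉.pullAut g) 𝔭, h𝔭'⟩ = ε * 𝔓.ncspEquivZ ⟨𝔭, h𝔭⟩ + c) :
    GeometryOfDivisorsPreserved T 𝔓 Ψ ι e := by
  obtain ⟨h₁, h₂, hc⟩ := hi hind
  exact
    { induced := hind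
      elements := ⟨h₁, h₂⟩
      primes := hc
      ncspIsos := preservesNcspComponentIsos_of_supportData' Ψ ι e 𝔖 hc
      cspIsos := preservesCspComponentIsos_of_supportData' Ψ ι e 𝔖 hc
      cspToNcsp := preservesCspToNcsp_of_criterion' Ψ ι e 𝔖 hc hP hW hCrit
      labels := preservesNcspLabels_of_supportData' Ψ ι e 𝔖 hc hP hAdj
      thetaOrbit := preservesThetaDivisorOrbit_of_profile' Ψ ι e 𝔖 hc
        (preservesNcspLabels_of_supportData' Ψ ι e 𝔖 hc hP hAdj) θ s hθ hdiv hAut }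

end Prop53vi

end FrobenioidThetaDivisors

end Literature.AnabelianGeometry.EtaleTheta
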